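import Literature.AlgebraicGeometry.Motives.SegreEmbeddingPoints
import Literature.AlgebraicGeometry.Motives.UniversalHyperplaneSection
import Mathlib.Algebra.MvPolynomial.Funext
import HarnessLib

/-!
# Segre–diagonal powers of projective space: hypersurfaces of degree `d` as hyperplane sections

Topic `Literature/AlgebraicGeometry/Motives` (family `hodge`; next to `SegreEmbedding`,
`SegreEmbeddingPoints`, `UniversalHyperplaneSection`). For a field `k` and `N : ℕ` this file
defines the **Segre–diagonal maps** `s_d : ℙᴺ_k ⟶ ℙ^{N_d}_k` (`segrePow N k d`; `s_0 = 𝟙`,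
`s_{d+1} = (s_d, 𝟙) ≫ Segre`, `N_d + 1 = (N+1)^{d+1}`, `segrePowDim`), which on homogeneous
coordinates are `[v] ↦ [v^{⊗(d+1)}]` (`map_segrePow_pointOfVec`, `powVec`), and proves that the
hyperplane sections of `X` re-embedded along `ψ ≫ s_d` (`ψ : X ⟶ ℙᴺ`) are exactly its hypersurface
sections of degree `d + 1`: every monomial of degree `d + 1` is a Segre coordinate of `v^{⊗(d+1)}`
(`exists_powVec_eq_prod_pow`), so a form `g` of degree `d + 1` is a linear form `c_g`
(`segreCoeff`) in those coordinates (`sum_segreCoeff_mul_powVec`), non-zero when `g ≠ 0` over an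
infinite field (`segreCoeff_ne_zero`, Mathlib `MvPolynomial.funext`), and the rational point
`(Q, [c_g])` lies in the incidence locus `{(x, a) | Σ aᵢ xᵢ(x) = 0}` of `ψ ≫ s_d`
(`Motives.incidenceLocus`, `UniversalHyperplaneSection`) iff `ψ(Q) ∈ V₊(g)`
(`pt_lift_segreCoeff_mem_incidenceLocus_iff_mem_zeroLocus'`; via the incidence criterion on
rational points `pt_lift_mem_incidenceLocus_iff`, from the Segre dictionary of
`SegreEmbeddingPoints`). Classically: the `d`-fold diagonal followed by the Segre embedding is the
`d`-uple (Veronese) embedding composed with a linear embedding (Hartshorne I Ex. 2.12–2.14,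
II Ex. 5.11); the tree has no Veronese embedding, and this substitute needs only the Segre
embedding already in the tree.

Purpose: the countable family of PROJECTIVE parameter spaces "tuples of hyperplanes of `ℙ^{N_d}`"
parametrises, through `s_d`, all closed subsets of the fibres of a projective family
(`Motives/ProjectiveClosedSetsForms`; structure theorem on algebraicity loci,
`HodgeTheory/AlgebraicityLocus*`).

## References

* [Hartshorne1977] R. Hartshorne, Algebraic Geometry (1977), I Ex. 2.12, Ex. 2.14; II Ex. 5.11,
  II §2 Prop. 2.5.
* [VoisinHodgeII2003] C. Voisin, Hodge Theory and Complex Algebraic Geometry II (2003), §3.2.2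
  (incidence variety).
-/

noncomputable section

open CategoryTheory AlgebraicGeometry Limits MonoidalCategory CartesianMonoidalCategory MvPolynomial

universe u

namespace Literature.AlgebraicGeometry.Motives

attribute [local instance] MvPolynomial.gradedAlgebra

namespace ProjectiveSpace

/-! ### The iterated Segre–diagonal maps `s_d : ℙᴺ ⟶ ℙ^{N_d}` -/

/-- The dimension `N_d` of the target of the `d`-th Segre–diagonal map of `ℙᴺ`
(`N_0 = N`, `N_{d+1} = N_d N + N_d + N`, i.e. `N_d + 1 = (N + 1)^{d+1}`). [folklore] -/
def segrePowDim (N : ℕ) : ℕ → ℕ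
  | 0 => N
  | d + 1 => segrePowDim N d * N + segrePowDim N d + N

variable (N : ℕ) (k : Type u) [Field k]

/-- **The Segre–diagonal maps** `s_d : ℙᴺ_k ⟶ ℙ^{N_d}_k` (`s_0 = 𝟙`, `s_{d+1} = (s_d, 𝟙) ≫ Segre`):
on homogeneous coordinates `[v] ↦ [v^{⊗(d+1)}]`, so that the hyperplane sections of `s_d(ℙᴺ)` are
exactly the hypersurfaces of degree `d + 1` of `ℙᴺ` (the composite of the `(d+1)`-fold diagonal
with the Segre embedding agrees with the `(d+1)`-uple embedding followed by a linear embedding;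
Hartshorne I Ex. 2.12–2.14, II Ex. 5.11). [cite: Hartshorne1977, I Ex. 2.12 and Ex. 2.14] -/
def segrePow : (d : ℕ) → (projectiveSpace N k ⟶ projectiveSpace (segrePowDim N d) k)
  | 0 => 𝟙 _
  | d + 1 => CartesianMonoidalCategory.lift (segrePow d) (𝟙 _) ≫
      segreEmbedding (segrePowDim N d) N k

variable {N k} {L : Type u} [Field L] [Algebra k L]

/-- The homogeneous coordinates `v^{⊗(d+1)}` of `s_d [v]` (`powVec v 0 = v`,
`powVec v (d+1) = powVec v d ⊗ v` in the lexicographic order `segreIndexEquiv`). [folklore] -/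
def powVec (v : Fin (N + 1) → L) : (d : ℕ) → (Fin (segrePowDim N d + 1) → L)
  | 0 => v
  | d + 1 => fun t => powVec v d ((segreIndexEquiv (segrePowDim N d) N).symm t).1 *
      v ((segreIndexEquiv (segrePowDim N d) N).symm t).2

/-- `powVec v (d + 1)` at the index `(J, j)` is `powVec v d J * v j`. [folklore] -/
@[simp]
theorem powVec_succ_apply (v : Fin (N + 1) → L) (d : ℕ) (J : Fin (segrePowDim N d + 1))
    (j : Fin (N + 1)) :
    powVec v (d + 1) (segreIndexEquiv (segrePowDim N d) N (J, j)) = powVec v d J * v j := by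
  simp [powVec]

/-- `v^{⊗(d+1)} ≠ 0` for `v ≠ 0`. [folklore] -/
theorem powVec_ne_zero {v : Fin (N + 1) → L} (hv : v ≠ 0) : ∀ d, powVec v d ≠ 0
  | 0 => hv
  | d + 1 => segreVec_ne_zero (powVec_ne_zero hv d) hv

/-- **`s_d` on homogeneous coordinates**: `s_d [v] = [v^{⊗(d+1)}]`
(`map_segreEmbedding_lift_pointOfVec`, by induction). [cite: Hartshorne1977, II Ex. 5.11] -/
theorem map_segrePow_pointOfVec (v : Fin (N + 1) → L) (hv : v ≠ 0) :
    ∀ d, AlgPoints.map (segrePow N k d) (pointOfVec k v hv) =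
      pointOfVec k (powVec v d) (powVec_ne_zero hv d)
  | 0 => AlgPoints.map_id_apply _
  | d + 1 => by
    change AlgPoints.map (CartesianMonoidalCategory.lift (segrePow N k d) (𝟙 _) ≫
      segreEmbedding (segrePowDim N d) N k) (pointOfVec k v hv) = _
    rw [AlgPoints.map_comp_apply]
    have h : AlgPoints.map (CartesianMonoidalCategory.lift (segrePow N k d) (𝟙 _))
        (pointOfVec k v hv) =
        CartesianMonoidalCategory.lift (pointOfVec k (powVec v d) (powVec_ne_zero hv d))
          (pointOfVec k v hv) := by
      rw [AlgPoints.map_apply, comp_lift, Category.comp_id, ← AlgPoints.map_apply,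
        map_segrePow_pointOfVec v hv d]
    rw [h, map_segreEmbedding_lift_pointOfVec]
    rfl

/-! ### Monomials of degree `d + 1` are Segre coordinates of `v^{⊗(d+1)}` -/

/-- Every monomial of degree `d + 1` in `v` is a coordinate of `v^{⊗(d+1)}`: for `μ` of degree
`d + 1` there is an index `J` with `powVec v d J = v^μ` for all `v`. [folklore] -/
theorem exists_powVec_eq_prod_pow : ∀ (d : ℕ) (μ : Fin (N + 1) →₀ ℕ), μ.degree = d + 1 →
    ∃ J : Fin (segrePowDim N d + 1), ∀ v : Fin (N + 1) → L, powVec v d J = ∏ i, v i ^ μ i := by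
  -- splitting off one variable from a monomial of positive degree
  have hsplit : ∀ (e : ℕ) (μ : Fin (N + 1) →₀ ℕ), μ.degree = e + 1 →
      ∃ (j : Fin (N + 1)) (μ' : Fin (N + 1) →₀ ℕ), μ'.degree = e ∧ μ = μ' + Finsupp.single j 1 := by
    intro e μ hμ
    have hne : μ ≠ 0 := by
      intro h0
      rw [h0, map_zero] at hμ
      exact Nat.succ_ne_zero e hμ.symm
    obtain ⟨j, hj⟩ : ∃ j, μ j ≠ 0 := by
      by_contra h
      push Not at h
      exact hne (Finsupp.ext h)
    have hle : Finsupp.single j 1 ≤ μ := Finsupp.single_le_iff.2 (Nat.one_le_iff_ne_zero.2 hj)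
    refine ⟨j, μ - Finsupp.single j 1, ?_, (tsub_add_cancel_of_le hle).symm⟩
    have h := congrArg Finsupp.degree (tsub_add_cancel_of_le hle)
    rw [map_add, Finsupp.degree_single, hμ] at h
    omega
  -- the product over a split monomial
  have hprod : ∀ (v : Fin (N + 1) → L) (μ' : Fin (N + 1) →₀ ℕ) (j : Fin (N + 1)),
      ∏ i, v i ^ (μ' + Finsupp.single j 1 : Fin (N + 1) →₀ ℕ) i = (∏ i, v i ^ μ' i) * v j := by
    intro v μ' j
    simp only [Finsupp.coe_add, Pi.add_apply, pow_add, Finset.prod_mul_distrib]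
    congr 1
    rw [Finset.prod_eq_single j (fun i _ hi => by simp [Ne.symm hi])
      (fun h => (h (Finset.mem_univ j)).elim)]
    simp
  intro d
  induction d with
  | zero =>
    intro μ hμ
    obtain ⟨j, μ', hμ', rfl⟩ := hsplit 0 μ hμ
    have h0 : μ' = 0 := (Finsupp.degree_eq_zero_iff _).1 hμ'
    subst h0
    refine ⟨j, fun v => ?_⟩
    rw [hprod]
    simp [powVec]
  | succ d ih =>
    intro μ hμ
    obtain ⟨j, μ', hμ', rfl⟩ := hsplit (d + 1) μ hμ
    obtain ⟨J, hJ⟩ := ih μ' hμ'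
    refine ⟨segreIndexEquiv (segrePowDim N d) N (J, j), fun v => ?_⟩
    rw [powVec_succ_apply, hJ v, hprod]

/-! ### Forms of degree `d + 1` as linear forms in the Segre coordinates -/

/-- A choice of Segre index for each monomial of degree `d + 1`. [folklore] -/
def segreIndexOfMonomial (d : ℕ) (μ : Fin (N + 1) →₀ ℕ) : Fin (segrePowDim N d + 1) :=
  if h : μ.degree = d + 1 then Classical.choose (exists_powVec_eq_prod_pow (L := k) d μ h) else 0

/-- The chosen Segre index of a monomial `μ` of degree `d + 1` realises it:
`(v^{⊗(d+1)})_{J(μ)} = v^μ`. [folklore] -/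
theorem powVec_segreIndexOfMonomial {d : ℕ} {μ : Fin (N + 1) →₀ ℕ} (h : μ.degree = d + 1)
    (v : Fin (N + 1) → k) :
    powVec v d (segreIndexOfMonomial (k := k) d μ) = ∏ i, v i ^ μ i := by
  rw [segreIndexOfMonomial, dif_pos h]
  exact Classical.choose_spec (exists_powVec_eq_prod_pow (L := k) d μ h) v

/-- **The coefficient vector of a form in Segre coordinates**: for `g ∈ k[x₀,…,x_N]` the vector
`c_g ∈ k^{N_d + 1}` collecting, for each Segre index `J`, the coefficients of the monomials of
degree `d + 1` of `g` assigned to `J`. [folklore] -/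
def segreCoeff (d : ℕ) (g : MvPolynomial (Fin (N + 1)) k) : Fin (segrePowDim N d + 1) → k :=
  fun J => ∑ μ ∈ g.support, if segreIndexOfMonomial (k := k) d μ = J then coeff μ g else 0

/-- **A form of degree `d + 1` is the linear form `c_g` in the Segre coordinates of `v^{⊗(d+1)}`**:
`Σ_J (c_g)_J (v^{⊗(d+1)})_J = g(v)`. [cite: Hartshorne1977, I Ex. 2.12] -/
theorem sum_segreCoeff_mul_powVec {d : ℕ} {g : MvPolynomial (Fin (N + 1)) k}
    (hg : g.IsHomogeneous (d + 1)) (v : Fin (N + 1) → k) :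
    ∑ J, segreCoeff d g J * powVec v d J = eval v g := by
  classical
  have hdeg : ∀ μ ∈ g.support, μ.degree = d + 1 := by
    intro μ hμ
    by_contra h
    exact (mem_support_iff.1 hμ) (hg.coeff_eq_zero h)
  calc ∑ J, segreCoeff d g J * powVec v d J
      = ∑ J, ∑ μ ∈ g.support,
          (if segreIndexOfMonomial (k := k) d μ = J then coeff μ g else 0) * powVec v d J := by
        simp only [segreCoeff, Finset.sum_mul]
    _ = ∑ μ ∈ g.support, ∑ J,
          (if segreIndexOfMonomial (k := k) d μ = J then coeff μ g else 0) * powVec v d J :=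
        Finset.sum_comm
    _ = ∑ μ ∈ g.support, coeff μ g * powVec v d (segreIndexOfMonomial (k := k) d μ) := by
        refine Finset.sum_congr rfl fun μ _ => ?_
        simp only [ite_mul, zero_mul, Finset.sum_ite_eq, Finset.mem_univ, if_true]
    _ = ∑ μ ∈ g.support, coeff μ g * ∏ i, v i ^ μ i := by
        refine Finset.sum_congr rfl fun μ hμ => ?_
        rw [powVec_segreIndexOfMonomial (hdeg μ hμ)]
    _ = eval v g := (eval_eq' v g).symm

/-- The coefficient vector of a NON-ZERO form of degree `d + 1` over an infinite field is non-zero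
(a polynomial vanishing at all points of `kᴺ⁺¹` is zero, Mathlib `MvPolynomial.funext`).
[folklore] -/
theorem segreCoeff_ne_zero [Infinite k] {d : ℕ} {g : MvPolynomial (Fin (N + 1)) k}
    (hg : g.IsHomogeneous (d + 1)) (hg0 : g ≠ 0) : segreCoeff d g ≠ 0 := by
  intro hc
  apply hg0
  refine MvPolynomial.funext fun v => ?_
  rw [← sum_segreCoeff_mul_powVec hg v, hc, map_zero]
  simp

/-! ### Incidence with hyperplanes, on rational points -/

variable {X : SchemeOver k}

/-- **The incidence locus on rational points.** For `φ : X ⟶ ℙᴹ_k`, a `k`-point `Q` of `X` with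
`φ(Q) = [w]`, and a hyperplane `[c] ∈ (ℙᴹ)^*(k)`: the point `(Q, [c])` of `X × (ℙᴹ)^*` lies in the
incidence locus `{(x, a) | Σ aᵢ xᵢ(x) = 0}` (`incidenceLocus M φ`) iff `Σᵢ wᵢ cᵢ = 0` (the Segre
dictionary `pt_map_segreEmbedding_lift_mem_zeroLocus_iff` applied to the incidence form
`Σᵢ z_{(i,i)}`). [cite: VoisinHodgeII2003, §3.2.2] [cite: Hartshorne1977, II Ex. 5.11] -/
theorem pt_lift_mem_incidenceLocus_iff {M : ℕ} (φ : X ⟶ projectiveSpace M k) (Q : AlgPoints X L)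
    {w : Fin (M + 1) → L} (hw : w ≠ 0) (hQ : AlgPoints.map φ Q = pointOfVec k w hw)
    {c : Fin (M + 1) → L} (hc : c ≠ 0) :
    AlgPoints.pt (CartesianMonoidalCategory.lift Q (pointOfVec k c hc) :
        AlgPoints (X ⊗ dualProjectiveSpace M k) L) ∈
      (incidenceLocus M φ : Set (X ⊗ dualProjectiveSpace M k).left) ↔
      ∑ i, w i * c i = 0 := by
  -- `pt` of the point versus `pt` of its image under `toSegre`
  change (toSegre M φ).left.base
      (AlgPoints.pt (CartesianMonoidalCategory.lift Q (pointOfVec k c hc) :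
        AlgPoints (X ⊗ dualProjectiveSpace M k) L)) ∈
    (incidenceHyperplane M k : Set (projectiveSpace (M * M + M + M) k).left) ↔ _
  rw [← AlgPoints.pt_map]
  have hmap : AlgPoints.map (toSegre M φ) (CartesianMonoidalCategory.lift Q (pointOfVec k c hc)) =
      AlgPoints.map (segreEmbedding M M k)
        (CartesianMonoidalCategory.lift (pointOfVec k w hw) (pointOfVec k c hc)) := by
    rw [toSegre, AlgPoints.map_comp_apply, AlgPoints.map_apply (φ ▷ _),
      CartesianMonoidalCategory.lift_whiskerRight, ← AlgPoints.map_apply, hQ]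
  rw [hmap]
  change (AlgPoints.map (segreEmbedding M M k)
      (CartesianMonoidalCategory.lift (pointOfVec k w hw) (pointOfVec k c hc))).pt ∈
    ProjectiveSpectrum.zeroLocus _ {incidenceForm M} ↔ _
  rw [pt_map_segreEmbedding_lift_mem_zeroLocus_iff w hw c hc one_pos
    ((mem_homogeneousSubmodule 1 _).2 (isHomogeneous_incidenceForm M))]
  simp [incidenceForm, map_sum]

/-- **Hyperplane sections of the Segre–diagonal image are the hypersurfaces of degree `d + 1`.**
For `ψ : X ⟶ ℙᴺ_k`, a `k`-point `Q` of `X` with `ψ(Q) = [v]`, and a non-zero form `g` of degree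
`d + 1` with Segre coefficient vector `c_g`: the point `(Q, [c_g])` lies in the incidence locus of
`ψ ≫ s_d : X ⟶ ℙ^{N_d}` iff `g(v) = 0`, i.e. iff `ψ(Q) ∈ V₊(g)`.
[cite: Hartshorne1977, I Ex. 2.12 and II Ex. 5.11] -/
theorem pt_lift_segreCoeff_mem_incidenceLocus_iff [Infinite k] (ψ : X ⟶ projectiveSpace N k)
    (Q : AlgPoints X k) {v : Fin (N + 1) → k} (hv : v ≠ 0)
    (hQ : AlgPoints.map ψ Q = pointOfVec k v hv) {d : ℕ} {g : MvPolynomial (Fin (N + 1)) k}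
    (hg : g.IsHomogeneous (d + 1)) (hg0 : g ≠ 0) :
    AlgPoints.pt (CartesianMonoidalCategory.lift Q
        (pointOfVec k (segreCoeff d g) (segreCoeff_ne_zero hg hg0)) :
        AlgPoints (X ⊗ dualProjectiveSpace (segrePowDim N d) k) k) ∈
      (incidenceLocus (segrePowDim N d) (ψ ≫ segrePow N k d) :
        Set (X ⊗ dualProjectiveSpace (segrePowDim N d) k).left) ↔ eval v g = 0 := by
  have hQ' : AlgPoints.map (ψ ≫ segrePow N k d) Q =
      pointOfVec k (powVec v d) (powVec_ne_zero hv d) := by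
    rw [AlgPoints.map_comp_apply, hQ, map_segrePow_pointOfVec]
  rw [pt_lift_mem_incidenceLocus_iff (ψ ≫ segrePow N k d) Q (powVec_ne_zero hv d) hQ',
    ← sum_segreCoeff_mul_powVec hg v]
  simp only [mul_comm]

/-- The same, as membership of `ψ(Q)` in the zero locus `V₊(g)`.
[cite: Hartshorne1977, II §2 Prop. 2.5] -/
theorem pt_lift_segreCoeff_mem_incidenceLocus_iff_mem_zeroLocus [Infinite k]
    (ψ : X ⟶ projectiveSpace N k) (Q : AlgPoints X k) {v : Fin (N + 1) → k} (hv : v ≠ 0)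
    (hQ : AlgPoints.map ψ Q = pointOfVec k v hv) {d : ℕ} {g : MvPolynomial (Fin (N + 1)) k}
    (hg : g.IsHomogeneous (d + 1)) (hg0 : g ≠ 0) :
    AlgPoints.pt (CartesianMonoidalCategory.lift Q
        (pointOfVec k (segreCoeff d g) (segreCoeff_ne_zero hg hg0)) :
        AlgPoints (X ⊗ dualProjectiveSpace (segrePowDim N d) k) k) ∈
      (incidenceLocus (segrePowDim N d) (ψ ≫ segrePow N k d) :
        Set (X ⊗ dualProjectiveSpace (segrePowDim N d) k).left) ↔
      (AlgPoints.map ψ Q).pt ∈ ProjectiveSpectrum.zeroLocus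
        (MvPolynomial.homogeneousSubmodule (Fin (N + 1)) k) {g} := by
  rw [pt_lift_segreCoeff_mem_incidenceLocus_iff ψ Q hv hQ hg hg0, hQ,
    pt_pointOfVec_mem_zeroLocus_iff v hv (Nat.succ_pos d) ((mem_homogeneousSubmodule _ _).2 hg)]
  exact Iff.rfl

/-- **Hyperplane sections of `X` re-embedded by `s_d` are its hypersurface sections of degree
`d + 1`** (coordinate-free form on rational points): for `ψ : X ⟶ ℙᴺ_k`, a non-zero form `g` of
degree `d + 1` and ANY `k`-point `Q` of `X`, the point `(Q, [c_g])` lies in the incidence locus of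
`ψ ≫ s_d` iff `ψ(Q) ∈ V₊(g)`. [cite: Hartshorne1977, I Ex. 2.12 and II Ex. 5.11] -/
theorem pt_lift_segreCoeff_mem_incidenceLocus_iff_mem_zeroLocus' [Infinite k]
    (ψ : X ⟶ projectiveSpace N k) (Q : AlgPoints X k) {d : ℕ} {g : MvPolynomial (Fin (N + 1)) k}
    (hg : g.IsHomogeneous (d + 1)) (hg0 : g ≠ 0) :
    AlgPoints.pt (CartesianMonoidalCategory.lift Q
        (pointOfVec k (segreCoeff d g) (segreCoeff_ne_zero hg hg0)) :
        AlgPoints (X ⊗ dualProjectiveSpace (segrePowDim N d) k) k) ∈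
      (incidenceLocus (segrePowDim N d) (ψ ≫ segrePow N k d) :
        Set (X ⊗ dualProjectiveSpace (segrePowDim N d) k).left) ↔
      (AlgPoints.map ψ Q).pt ∈ ProjectiveSpectrum.zeroLocus
        (MvPolynomial.homogeneousSubmodule (Fin (N + 1)) k) {g} := by
  obtain ⟨v, hv, hQ⟩ := exists_eq_pointOfVec (AlgPoints.map ψ Q)
  exact pt_lift_segreCoeff_mem_incidenceLocus_iff_mem_zeroLocus ψ Q hv hQ hg hg0

end ProjectiveSpace

end Literature.AlgebraicGeometry.Motives

end
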